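import Mathlib.Analysis.SpecialFunctions.Pow.Deriv
import Literature.Analysis.FluidPDE.ElgindiSinRpowIntegral
import Literature.Analysis.FluidPDE.ElgindiAngularHardy
import HarnessLib

/-!
# The sharp weighted Hardy inequality of Elgindi ([Elgindi2021] Lemma 7.4 / Corollary 7.6)

Topic `Literature/Analysis/FluidPDE`. Proof file (everything proved, no definitions, no named
facts) on the proof path of the named fact
`Literature.Analysis.FluidPDE.Elgindi.ElgindiGhoulMasmoudi2021_stabilityCore`
(`ElgindiStabilityDecomposition.lean`). T. M. Elgindi, Ann. of Math. 194 (2021) =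
arXiv:1904.04795, §7.2 "Hardy Inequalities" (p. 20 of the held text):

> "We also need the following sharp version of Lemma 7.2.
> **Lemma 7.4.** Let `f ∈ H¹([0,π])` and `0 ≤ η ≤ 1`. Assume that `f(0) = f(π) = 0`. Then,
> `∫₀^π |f(θ)|²/sin^{2+η}(θ) dθ ≤ (4/(η+1)²)∫₀^π |f'(θ)|²/sin^η(θ) dθ + 100|f|²_{H¹}`.
> **Remark 7.5.** The lemma is sharp in terms of the size of the first constant; the size of the
> second constant is irrelevant for our purposes. […]
> We now have the following corollary which follows from Lemma 7.4 by scaling.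
> **Corollary 7.6.** Let `f ∈ H¹([0,π/2])` and `0 ≤ η ≤ 1`. Assume that `f(0) = f(π/2) = 0`. Then,
> `∫₀^{π/2} |f(θ)|²/sin^{2+η}(2θ) dθ ≤ (1/(η+1)²)∫₀^{π/2} |f'(θ)|²/sin^η(2θ) dθ + 100|f|²_{H¹}`."

Corollary 7.6 is the inequality used (in Step 2 of the proof of Proposition 7.7, the `𝓗²`
elliptic estimate, where the margin `1 − 2η(η+1)·(η+1)^{−2} = (1−η)/(1+η) = 1/199` at
`η = 99/100` makes the sharp first constant indispensable). We prove it for `f ∈ C¹(ℝ)` with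
`f(0) = f(π/2) = 0` and `0 ≤ η < 1` (the case used downstream: there `η = 99/100` and `f` is a
slice of a smooth profile; for `η = 1` both sides are `+∞` for a generic such `f`), in the
slightly STRONGER form without any lower-order term,

  `(1+η)² ∫₀^{π/2} f²/sin^{2+η}(2θ) + (1−η²) ∫₀^{π/2} f²/sin^η(2θ) ≤ ∫₀^{π/2} f'²/sin^η(2θ)`

(`sharpHardy_sin_two_mul`; the printed Corollary 7.6 with `100|f|²_{H¹}` replaced by `0` is
`sharpHardy_sin_two_mul'`). PROOF (a one-line sharpening of the printed comparison argument, by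
the classical ground-state substitution `g = sin(2θ)^{(1+η)/2}`): with `s = sin 2θ`, `c = cos 2θ`,
`u = s^{−η}` and the boundary function `F = (1+η)·c·f²·u/s` one has on `(0, π/2)` the pointwise
identity `f'²u − (1+η)²(f/s)²u − (1−η²)f²u − F' = (f' − (1+η)(c/s)f)²u ≥ 0` (using `c² + s² = 1`),
while `|F| ≤ (1+η)K²s^{1−η} → 0` at both endpoints (`|f| ≤ K sin 2θ` on `[0, π/2]` for `C¹`
functions vanishing at `0` and `π/2`), so that `∫₀^{π/2} F' = 0` by the fundamental theorem of
calculus on the open interval. All weights are written as `(…)·sin(2θ)^{−η}` (real powers), the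
form in which `integrableOn_sin_two_mul_rpow` (`ElgindiSinRpowIntegral.lean`) provides
integrability; the integrability of the three integrands is recorded separately.
-/

noncomputable section

open MeasureTheory Set Real Filter intervalIntegral
open _root_.Topology

namespace Literature.Analysis.FluidPDE

namespace Elgindi

/-! ### `|f| ≤ K sin(2θ)` on the quarter period -/

/-- For `f ∈ C¹` with `f(0) = f(π/2) = 0`: `|f(θ)| ≤ K·sin(2θ)` on `[0, π/2]` for some `K ≥ 0`
(Lipschitz bounds from both endpoints and Jordan's inequality). [folklore] -/
theorem exists_abs_le_mul_sin_two_mul {f : ℝ → ℝ} (hf : ContDiff ℝ 1 f) (h0 : f 0 = 0)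
    (h1 : f (π / 2) = 0) :
    ∃ K, 0 ≤ K ∧ ∀ θ ∈ Icc 0 (π / 2), |f θ| ≤ K * Real.sin (2 * θ) := by
  obtain ⟨M₁, hM₁0, hM₁⟩ := exists_abs_le_mul_of_deriv hf h0 (π / 2)
  have hgc : ContDiff ℝ 1 (fun y => f (π / 2 - y)) := hf.comp (contDiff_const.sub contDiff_id)
  have hg0 : (fun y => f (π / 2 - y)) 0 = 0 := by simp [h1]
  obtain ⟨M₂, hM₂0, hM₂⟩ := exists_abs_le_mul_of_deriv hgc hg0 (π / 2)
  refine ⟨(M₁ + M₂) * (π / 4), by positivity, fun θ hθ => ?_⟩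
  rcases le_or_gt θ (π / 4) with hle | hgt
  · have hj : 2 / π * (2 * θ) ≤ Real.sin (2 * θ) :=
      Real.mul_le_sin (by linarith [hθ.1]) (by linarith)
    have h := hM₁ θ (by rw [abs_of_nonneg hθ.1]; exact hθ.2)
    rw [abs_of_nonneg hθ.1] at h
    have hθle : θ ≤ π / 4 * Real.sin (2 * θ) := by
      have := mul_le_mul_of_nonneg_left hj (by positivity : (0 : ℝ) ≤ π / 4)
      calc θ = π / 4 * (2 / π * (2 * θ)) := by field_simp; ring
        _ ≤ _ := this
    have hs0 : 0 ≤ Real.sin (2 * θ) := by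
      have : (0 : ℝ) ≤ 2 / π * (2 * θ) := by have := hθ.1; positivity
      linarith
    calc |f θ| ≤ M₁ * θ := h
      _ ≤ M₁ * (π / 4 * Real.sin (2 * θ)) := mul_le_mul_of_nonneg_left hθle hM₁0
      _ ≤ (M₁ + M₂) * (π / 4) * Real.sin (2 * θ) := by
          nlinarith [mul_nonneg hM₂0 hs0, Real.pi_pos]
  · have hj : 2 / π * (π - 2 * θ) ≤ Real.sin (π - 2 * θ) :=
      Real.mul_le_sin (by linarith [hθ.2]) (by linarith)
    rw [Real.sin_pi_sub] at hj
    have hy : |π / 2 - θ| ≤ π / 2 := by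
      rw [abs_of_nonneg (by linarith [hθ.2])]; linarith [hθ.1]
    have h := hM₂ (π / 2 - θ) hy
    simp only [sub_sub_cancel] at h
    rw [abs_of_nonneg (by linarith [hθ.2] : (0 : ℝ) ≤ π / 2 - θ)] at h
    have hθle : π / 2 - θ ≤ π / 4 * Real.sin (2 * θ) := by
      have := mul_le_mul_of_nonneg_left hj (by positivity : (0 : ℝ) ≤ π / 4)
      calc π / 2 - θ = π / 4 * (2 / π * (π - 2 * θ)) := by field_simp; ring
        _ ≤ _ := this
    have hs0 : 0 ≤ Real.sin (2 * θ) := by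
      have h2 : 0 ≤ π - 2 * θ := by linarith [hθ.2]
      have : (0 : ℝ) ≤ 2 / π * (π - 2 * θ) := by positivity
      linarith
    calc |f θ| ≤ M₂ * (π / 2 - θ) := h
      _ ≤ M₂ * (π / 4 * Real.sin (2 * θ)) := mul_le_mul_of_nonneg_left hθle hM₂0
      _ ≤ (M₁ + M₂) * (π / 4) * Real.sin (2 * θ) := by
          nlinarith [mul_nonneg hM₁0 hs0, Real.pi_pos]

/-! ### Integrability of the weighted integrands -/

/-- A measurable `g` with `|g| ≤ C` on `(0, π/2)` gives an integrable `g·sin(2θ)^{−η}` there,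
`0 ≤ η < 1`. [folklore] -/
theorem integrableOn_mul_sin_two_mul_rpow_of_abs_le {η : ℝ} (hη0 : 0 ≤ η) (hη1 : η < 1)
    {g : ℝ → ℝ} (hg : Measurable g) {C : ℝ} (hC : ∀ θ ∈ Ioo 0 (π / 2), |g θ| ≤ C) :
    IntegrableOn (fun θ => g θ * Real.sin (2 * θ) ^ (-η)) (Ioo 0 (π / 2)) := by
  have iu := integrableOn_sin_two_mul_rpow (r := -η) (by linarith) (by linarith)
  have hm : Measurable fun θ : ℝ => g θ * Real.sin (2 * θ) ^ (-η) :=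
    hg.mul ((by fun_prop : Measurable fun θ : ℝ => Real.sin (2 * θ)).pow_const _)
  refine Integrable.mono' (iu.const_mul C) hm.aestronglyMeasurable ?_
  rw [ae_restrict_iff' measurableSet_Ioo]
  refine Filter.Eventually.of_forall fun θ hθ => ?_
  have hs : 0 < Real.sin (2 * θ) :=
    Real.sin_pos_of_pos_of_lt_pi (by linarith [hθ.1]) (by linarith [hθ.2])
  have hu : 0 ≤ Real.sin (2 * θ) ^ (-η) := Real.rpow_nonneg hs.le _
  rw [Real.norm_eq_abs, abs_mul, abs_of_nonneg hu]
  exact mul_le_mul_of_nonneg_right (hC θ hθ) hu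

/-- `f'²·sin(2θ)^{−η}` is integrable on `(0, π/2)` for `f ∈ C¹`, `0 ≤ η < 1`. [folklore] -/
theorem integrableOn_deriv_sq_mul_rpow {η : ℝ} (hη0 : 0 ≤ η) (hη1 : η < 1) {f : ℝ → ℝ}
    (hf : ContDiff ℝ 1 f) :
    IntegrableOn (fun θ => deriv f θ ^ 2 * Real.sin (2 * θ) ^ (-η)) (Ioo 0 (π / 2)) := by
  have hdc : Continuous (deriv f) := hf.continuous_deriv le_rfl
  obtain ⟨M, hM⟩ := isCompact_Icc.exists_bound_of_continuousOn (s := Icc 0 (π / 2)) hdc.continuousOn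
  refine integrableOn_mul_sin_two_mul_rpow_of_abs_le hη0 hη1 (hdc.measurable.pow_const 2)
    (C := M ^ 2) fun θ hθ => ?_
  have h := hM θ (Ioo_subset_Icc_self hθ)
  rw [Real.norm_eq_abs] at h
  rw [abs_of_nonneg (sq_nonneg _), ← sq_abs]
  exact pow_le_pow_left₀ (abs_nonneg _) h 2

/-- `f²·sin(2θ)^{−η}` is integrable on `(0, π/2)` for continuous `f`, `0 ≤ η < 1`. [folklore] -/
theorem integrableOn_sq_mul_rpow {η : ℝ} (hη0 : 0 ≤ η) (hη1 : η < 1) {f : ℝ → ℝ}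
    (hf : Continuous f) :
    IntegrableOn (fun θ => f θ ^ 2 * Real.sin (2 * θ) ^ (-η)) (Ioo 0 (π / 2)) := by
  obtain ⟨M, hM⟩ := isCompact_Icc.exists_bound_of_continuousOn (s := Icc 0 (π / 2)) hf.continuousOn
  refine integrableOn_mul_sin_two_mul_rpow_of_abs_le hη0 hη1 (hf.measurable.pow_const 2)
    (C := M ^ 2) fun θ hθ => ?_
  have h := hM θ (Ioo_subset_Icc_self hθ)
  rw [Real.norm_eq_abs] at h
  rw [abs_of_nonneg (sq_nonneg _), ← sq_abs]
  exact pow_le_pow_left₀ (abs_nonneg _) h 2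

/-- `(f/sin 2θ)²·sin(2θ)^{−η}` is integrable on `(0, π/2)` for `f ∈ C¹` with `f(0) = f(π/2) = 0`,
`0 ≤ η < 1` (the integrand is `O(sin(2θ)^{−η})` by `exists_abs_le_mul_sin_two_mul`). [folklore] -/
theorem integrableOn_div_sin_sq_mul_rpow {η : ℝ} (hη0 : 0 ≤ η) (hη1 : η < 1) {f : ℝ → ℝ}
    (hf : ContDiff ℝ 1 f) (h0 : f 0 = 0) (h1 : f (π / 2) = 0) :
    IntegrableOn (fun θ => (f θ / Real.sin (2 * θ)) ^ 2 * Real.sin (2 * θ) ^ (-η))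
      (Ioo 0 (π / 2)) := by
  obtain ⟨K, hK0, hK⟩ := exists_abs_le_mul_sin_two_mul hf h0 h1
  have hm : Measurable fun θ => (f θ / Real.sin (2 * θ)) ^ 2 :=
    (hf.continuous.measurable.div (by fun_prop : Measurable fun θ : ℝ => Real.sin (2 * θ))).pow_const 2
  refine integrableOn_mul_sin_two_mul_rpow_of_abs_le hη0 hη1 hm (C := K ^ 2) fun θ hθ => ?_
  have hs : 0 < Real.sin (2 * θ) :=
    Real.sin_pos_of_pos_of_lt_pi (by linarith [hθ.1]) (by linarith [hθ.2])
  have h := hK θ (Ioo_subset_Icc_self hθ)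
  have hq : |f θ / Real.sin (2 * θ)| ≤ K := by
    rw [abs_div, abs_of_pos hs, div_le_iff₀ hs]; exact h
  rw [abs_of_nonneg (sq_nonneg _), ← sq_abs]
  exact pow_le_pow_left₀ (abs_nonneg _) hq 2

/-! ### Pointwise algebra of the ground-state substitution -/

/-- The pointwise identity behind the sharp inequality: with `c² + s² = 1`, `r·s = 1`,
`f'²u − (1+η)²(pr)²u − (1−η²)p²u − F' = (q − (1+η)c r p)²u`, where
`F' = (1+η)(−2p²u + 2cpqur − 2(1+η)c²p²ur²)` is the derivative of the boundary function
`F = (1+η)c p² r u` along `s' = 2c`, `c' = −2s`, `u' = −2ηcur`. [folklore] -/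
theorem sharpHardy_pointwise_identity (η s c u r p q : ℝ) (hc : c ^ 2 + s ^ 2 = 1)
    (hr : r * s = 1) :
    q ^ 2 * u - (1 + η) ^ 2 * (p * r) ^ 2 * u - (1 - η ^ 2) * p ^ 2 * u -
        (1 + η) * (-2 * p ^ 2 * u + 2 * c * p * q * u * r - 2 * (1 + η) * c ^ 2 * p ^ 2 * u * r ^ 2) =
      (q - (1 + η) * c * r * p) ^ 2 * u := by
  linear_combination ((1 + η) ^ 2 * p ^ 2 * u * r ^ 2) * hc -
    ((1 + η) ^ 2 * p ^ 2 * u * (r * s + 1)) * hr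

/-- The pointwise inequality `F' ≤ f'²u − (1+η)²(pr)²u − (1−η²)p²u` (`u ≥ 0`). [folklore] -/
theorem sharpHardy_pointwise_le (η s c u r p q : ℝ) (hc : c ^ 2 + s ^ 2 = 1) (hr : r * s = 1)
    (hu : 0 ≤ u) :
    (1 + η) * (-2 * p ^ 2 * u + 2 * c * p * q * u * r - 2 * (1 + η) * c ^ 2 * p ^ 2 * u * r ^ 2) ≤
      q ^ 2 * u - (1 + η) ^ 2 * (p * r) ^ 2 * u - (1 - η ^ 2) * p ^ 2 * u := by
  have h := sharpHardy_pointwise_identity η s c u r p q hc hr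
  nlinarith [mul_nonneg (sq_nonneg (q - (1 + η) * c * r * p)) hu]

/-- Size of the derivative of the boundary function: `|F'| ≤ (1+η)(2K² + 2KM + 2(1+η)K²)·u` when
`|p| ≤ Ks`, `|q| ≤ M`, `|c| ≤ 1`, `0 < s ≤ 1`, `rs = 1`, `u ≥ 0`, `K, η ≥ 0`. [folklore] -/
theorem sharpHardy_deriv_bound {η s c u r p q K M : ℝ} (hη : 0 ≤ η) (hs : 0 < s) (hs1 : s ≤ 1)
    (hc : |c| ≤ 1) (hr : r * s = 1) (hu : 0 ≤ u) (hK : 0 ≤ K) (hp : |p| ≤ K * s) (hq : |q| ≤ M) :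
    |(1 + η) * (-2 * p ^ 2 * u + 2 * c * p * q * u * r - 2 * (1 + η) * c ^ 2 * p ^ 2 * u * r ^ 2)| ≤
      (1 + η) * (2 * K ^ 2 + 2 * K * M + 2 * (1 + η) * K ^ 2) * u := by
  have hr0 : 0 < r := by
    rcases lt_trichotomy r 0 with h | h | h
    · nlinarith
    · rw [h, zero_mul] at hr; norm_num at hr
    · exact h
  -- `a := p r` satisfies `|a| ≤ K`
  have ha : |p * r| ≤ K := by
    rw [abs_mul, abs_of_pos hr0]
    calc |p| * r ≤ K * s * r := mul_le_mul_of_nonneg_right hp hr0.le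
      _ = K * (r * s) := by ring
      _ = K := by rw [hr, mul_one]
  have hpr : p = p * r * s := by rw [mul_assoc, hr, mul_one]
  have ha2 : (p * r) ^ 2 ≤ K ^ 2 := by
    rw [← sq_abs]; exact pow_le_pow_left₀ (abs_nonneg _) ha 2
  have hc2 : c ^ 2 ≤ 1 := by
    rw [← sq_abs]; nlinarith [abs_nonneg c]
  have hs2 : s ^ 2 ≤ 1 := by nlinarith
  -- the three pieces
  have e1 : p ^ 2 * u = (p * r) ^ 2 * s ^ 2 * u := by
    conv_lhs => rw [hpr]
    ring
  have e2 : c * p * q * u * r = c * (p * r) * q * u := by ring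
  have e3 : c ^ 2 * p ^ 2 * u * r ^ 2 = c ^ 2 * (p * r) ^ 2 * u := by ring
  have b1 : p ^ 2 * u ≤ K ^ 2 * u := by
    rw [e1]
    have : (p * r) ^ 2 * s ^ 2 ≤ K ^ 2 * 1 :=
      mul_le_mul ha2 hs2 (sq_nonneg _) (sq_nonneg _)
    nlinarith
  have b2 : |c * p * q * u * r| ≤ K * M * u := by
    rw [e2, abs_mul, abs_of_nonneg hu, abs_mul, abs_mul]
    have h1 : |c| * |p * r| ≤ 1 * K := mul_le_mul hc ha (abs_nonneg _) zero_le_one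
    have h2 : |c| * |p * r| * |q| ≤ 1 * K * M :=
      mul_le_mul h1 hq (abs_nonneg _) (by positivity)
    nlinarith
  have b3 : c ^ 2 * p ^ 2 * u * r ^ 2 ≤ K ^ 2 * u := by
    rw [e3]
    have : c ^ 2 * (p * r) ^ 2 ≤ 1 * K ^ 2 := mul_le_mul hc2 ha2 (sq_nonneg _) zero_le_one
    nlinarith
  have b1' : 0 ≤ p ^ 2 * u := by positivity
  have b3' : 0 ≤ c ^ 2 * p ^ 2 * u * r ^ 2 := by positivity
  have hb2 := abs_le.1 b2
  have hη' : (0 : ℝ) ≤ 1 + η := by linarith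
  have b4 := mul_le_mul_of_nonneg_left b3 hη'
  have hK2u : 0 ≤ K ^ 2 * u := mul_nonneg (sq_nonneg K) hu
  have hinner : |-2 * p ^ 2 * u + 2 * c * p * q * u * r - 2 * (1 + η) * c ^ 2 * p ^ 2 * u * r ^ 2| ≤
      (2 * K ^ 2 + 2 * K * M + 2 * (1 + η) * K ^ 2) * u := by
    rw [abs_le]
    constructor
    · nlinarith [mul_nonneg hη b3', mul_nonneg hη hK2u]
    · nlinarith [mul_nonneg hη b3', mul_nonneg hη hK2u]
  rw [abs_mul, abs_of_nonneg hη']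
  calc (1 + η) * |-2 * p ^ 2 * u + 2 * c * p * q * u * r - 2 * (1 + η) * c ^ 2 * p ^ 2 * u * r ^ 2|
      ≤ (1 + η) * ((2 * K ^ 2 + 2 * K * M + 2 * (1 + η) * K ^ 2) * u) :=
        mul_le_mul_of_nonneg_left hinner hη'
    _ = _ := by ring

/-! ### The sharp inequality -/

/-- **Sharp weighted Hardy inequality on the quarter period** (Corollary 7.6 of [Elgindi2021],
strengthened: no lower-order term): for `0 ≤ η < 1` and `f ∈ C¹(ℝ)` with `f(0) = f(π/2) = 0`,
`(1+η)²∫₀^{π/2} (f/sin 2θ)²·sin(2θ)^{−η} + (1−η²)∫₀^{π/2} f²·sin(2θ)^{−η} ≤ ∫₀^{π/2} f'²·sin(2θ)^{−η}`.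
[cite: Elgindi2021, §7.2 Lemma 7.4, Remark 7.5 and Corollary 7.6 (p. 20 of arXiv:1904.04795)] -/
theorem sharpHardy_sin_two_mul {η : ℝ} (hη0 : 0 ≤ η) (hη1 : η < 1) {f : ℝ → ℝ}
    (hf : ContDiff ℝ 1 f) (h0 : f 0 = 0) (h1 : f (π / 2) = 0) :
    (1 + η) ^ 2 * (∫ θ in Ioo 0 (π / 2), (f θ / Real.sin (2 * θ)) ^ 2 * Real.sin (2 * θ) ^ (-η)) +
        (1 - η ^ 2) * (∫ θ in Ioo 0 (π / 2), f θ ^ 2 * Real.sin (2 * θ) ^ (-η)) ≤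
      ∫ θ in Ioo 0 (π / 2), deriv f θ ^ 2 * Real.sin (2 * θ) ^ (-η) := by
  have hb : (0 : ℝ) < π / 2 := by positivity
  have hd : Differentiable ℝ f := hf.differentiable (by simp)
  have hfc : Continuous f := hf.continuous
  have hdc : Continuous (deriv f) := hf.continuous_deriv le_rfl
  obtain ⟨M, hM'⟩ := isCompact_Icc.exists_bound_of_continuousOn (s := Icc 0 (π / 2)) hdc.continuousOn
  have hM0 : 0 ≤ M := (norm_nonneg _).trans (hM' 0 ⟨le_rfl, hb.le⟩)
  have hM : ∀ θ ∈ Ioo 0 (π / 2), |deriv f θ| ≤ M := fun θ hθ => by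
    have := hM' θ (Ioo_subset_Icc_self hθ); rwa [Real.norm_eq_abs] at this
  obtain ⟨K, hK0, hK⟩ := exists_abs_le_mul_sin_two_mul hf h0 h1
  -- facts on the open quarter period
  have hsin : ∀ θ ∈ Ioo 0 (π / 2), 0 < Real.sin (2 * θ) := fun θ hθ =>
    Real.sin_pos_of_pos_of_lt_pi (by linarith [hθ.1]) (by linarith [hθ.2])
  -- the boundary function and its derivative
  set F : ℝ → ℝ := fun θ => (1 + η) * Real.cos (2 * θ) * f θ ^ 2 * (Real.sin (2 * θ))⁻¹ *
    Real.sin (2 * θ) ^ (-η) with hF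
  set F' : ℝ → ℝ := fun θ => (1 + η) * (-2 * f θ ^ 2 * Real.sin (2 * θ) ^ (-η) +
    2 * Real.cos (2 * θ) * f θ * deriv f θ * Real.sin (2 * θ) ^ (-η) * (Real.sin (2 * θ))⁻¹ -
    2 * (1 + η) * Real.cos (2 * θ) ^ 2 * f θ ^ 2 * Real.sin (2 * θ) ^ (-η) *
      (Real.sin (2 * θ))⁻¹ ^ 2) with hF'
  have hderiv : ∀ θ ∈ Ioo 0 (π / 2), HasDerivAt F (F' θ) θ := by
    intro θ hθ
    have hs := hsin θ hθ
    have hsne : Real.sin (2 * θ) ≠ 0 := hs.ne'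
    have h2 : HasDerivAt (fun x : ℝ => 2 * x) 2 θ := by
      simpa using (hasDerivAt_id' θ).const_mul (2 : ℝ)
    have hS : HasDerivAt (fun x => Real.sin (2 * x)) (Real.cos (2 * θ) * 2) θ := h2.sin
    have hC : HasDerivAt (fun x => Real.cos (2 * x)) (-Real.sin (2 * θ) * 2) θ := h2.cos
    have hU : HasDerivAt (fun x => Real.sin (2 * x) ^ (-η))
        (Real.cos (2 * θ) * 2 * (-η) * Real.sin (2 * θ) ^ (-η - 1)) θ :=
      hS.rpow_const (Or.inl hsne)
    have hI : HasDerivAt (fun x => (Real.sin (2 * x))⁻¹)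
        (-(Real.cos (2 * θ) * 2) / Real.sin (2 * θ) ^ 2) θ := hS.fun_inv hsne
    have e2 : (fun y => f y ^ 2) = fun y => f y * f y := by funext y; ring
    have hP : HasDerivAt (fun y => f y ^ 2) (2 * f θ * deriv f θ) θ := by
      rw [e2]
      exact ((hd θ).hasDerivAt.mul (hd θ).hasDerivAt).congr_deriv (by ring)
    have hall := (((hC.const_mul (1 + η)).fun_mul hP).fun_mul hI).fun_mul hU
    refine hall.congr_deriv ?_
    rw [Real.rpow_sub_one hsne]
    simp only [hF']
    field_simp
    ring
  -- pointwise consequences of `|f| ≤ K sin 2θ`, `|f'| ≤ M`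
  have hF'le : ∀ θ ∈ Ioo 0 (π / 2), F' θ ≤ deriv f θ ^ 2 * Real.sin (2 * θ) ^ (-η) -
      (1 + η) ^ 2 * ((f θ / Real.sin (2 * θ)) ^ 2 * Real.sin (2 * θ) ^ (-η)) -
      (1 - η ^ 2) * (f θ ^ 2 * Real.sin (2 * θ) ^ (-η)) := by
    intro θ hθ
    have hs := hsin θ hθ
    have hc : Real.cos (2 * θ) ^ 2 + Real.sin (2 * θ) ^ 2 = 1 := Real.cos_sq_add_sin_sq _
    have hr : (Real.sin (2 * θ))⁻¹ * Real.sin (2 * θ) = 1 := inv_mul_cancel₀ hs.ne'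
    have hu : 0 ≤ Real.sin (2 * θ) ^ (-η) := Real.rpow_nonneg hs.le _
    have h := sharpHardy_pointwise_le η _ _ _ _ (f θ) (deriv f θ) hc hr hu
    simp only [hF']
    rw [div_eq_mul_inv]
    nlinarith [h]
  have hF'abs : ∀ θ ∈ Ioo 0 (π / 2),
      |F' θ| ≤ (1 + η) * (2 * K ^ 2 + 2 * K * M + 2 * (1 + η) * K ^ 2) * Real.sin (2 * θ) ^ (-η) := by
    intro θ hθ
    have hs := hsin θ hθ
    have hr : (Real.sin (2 * θ))⁻¹ * Real.sin (2 * θ) = 1 := inv_mul_cancel₀ hs.ne'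
    have hu : 0 ≤ Real.sin (2 * θ) ^ (-η) := Real.rpow_nonneg hs.le _
    have h := sharpHardy_deriv_bound (c := Real.cos (2 * θ)) (p := f θ) (q := deriv f θ) hη0 hs
      (Real.sin_le_one _) (Real.abs_cos_le_one _) hr hu hK0 (hK θ (Ioo_subset_Icc_self hθ)) (hM θ hθ)
    simp only [hF']
    exact h
  have hFabs : ∀ θ ∈ Ioo 0 (π / 2), |F θ| ≤ (1 + η) * K ^ 2 * Real.sin (2 * θ) ^ (1 - η) := by
    intro θ hθ
    have hs := hsin θ hθ
    have hu : 0 ≤ Real.sin (2 * θ) ^ (-η) := Real.rpow_nonneg hs.le _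
    have e : Real.sin (2 * θ) ^ (1 - η) = Real.sin (2 * θ) * Real.sin (2 * θ) ^ (-η) := by
      rw [sub_eq_add_neg, Real.rpow_add hs, Real.rpow_one]
    have hp := hK θ (Ioo_subset_Icc_self hθ)
    have hp2 : f θ ^ 2 ≤ (K * Real.sin (2 * θ)) ^ 2 := by
      rw [← sq_abs]; exact pow_le_pow_left₀ (abs_nonneg _) hp 2
    have hη' : (0 : ℝ) ≤ 1 + η := by linarith
    have h1' : |f θ| ^ 2 * (Real.sin (2 * θ))⁻¹ ≤ K ^ 2 * Real.sin (2 * θ) := by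
      rw [← div_eq_mul_inv, div_le_iff₀ hs]
      calc |f θ| ^ 2 ≤ (K * Real.sin (2 * θ)) ^ 2 := pow_le_pow_left₀ (abs_nonneg _) hp 2
        _ = K ^ 2 * Real.sin (2 * θ) * Real.sin (2 * θ) := by ring
    have hc := Real.abs_cos_le_one (2 * θ)
    have step : |Real.cos (2 * θ)| * (|f θ| ^ 2 * (Real.sin (2 * θ))⁻¹) ≤ 1 * (K ^ 2 * Real.sin (2 * θ)) :=
      mul_le_mul hc h1' (mul_nonneg (sq_nonneg _) (inv_pos.2 hs).le) zero_le_one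
    rw [e]
    simp only [hF, abs_mul, abs_inv, abs_pow, abs_of_pos hs, abs_of_nonneg hu, abs_of_nonneg hη']
    calc (1 + η) * |Real.cos (2 * θ)| * |f θ| ^ 2 * (Real.sin (2 * θ))⁻¹ * Real.sin (2 * θ) ^ (-η)
        = (1 + η) * (|Real.cos (2 * θ)| * (|f θ| ^ 2 * (Real.sin (2 * θ))⁻¹)) * Real.sin (2 * θ) ^ (-η) := by
          ring
      _ ≤ (1 + η) * (1 * (K ^ 2 * Real.sin (2 * θ))) * Real.sin (2 * θ) ^ (-η) :=
          mul_le_mul_of_nonneg_right (mul_le_mul_of_nonneg_left step hη') hu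
      _ = (1 + η) * K ^ 2 * (Real.sin (2 * θ) * Real.sin (2 * θ) ^ (-η)) := by ring
  -- the boundary function tends to `0` at both endpoints
  have hg : Continuous fun θ : ℝ => (1 + η) * K ^ 2 * Real.sin (2 * θ) ^ (1 - η) :=
    continuous_const.mul ((by fun_prop : Continuous fun θ : ℝ => Real.sin (2 * θ)).rpow_const
      fun _ => Or.inr (by linarith))
  have hg0 : (1 + η) * K ^ 2 * Real.sin (2 * 0) ^ (1 - η) = 0 := by
    simp [Real.zero_rpow (by linarith : (1 : ℝ) - η ≠ 0)]
  have hgb : (1 + η) * K ^ 2 * Real.sin (2 * (π / 2)) ^ (1 - η) = 0 := by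
    have : Real.sin (2 * (π / 2)) = 0 := by rw [show 2 * (π / 2) = π by ring, Real.sin_pi]
    simp [this, Real.zero_rpow (by linarith : (1 : ℝ) - η ≠ 0)]
  have hlim0 : Tendsto F (𝓝[>] 0) (𝓝 0) := by
    refine squeeze_zero_norm' (a := fun θ => (1 + η) * K ^ 2 * Real.sin (2 * θ) ^ (1 - η)) ?_ ?_
    · filter_upwards [Ioo_mem_nhdsGT hb] with θ hθ
      rw [Real.norm_eq_abs]; exact hFabs θ hθ
    · have := (hg.tendsto 0).mono_left (nhdsWithin_le_nhds (s := Ioi (0 : ℝ)))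
      rwa [hg0] at this
  have hlimb : Tendsto F (𝓝[<] (π / 2)) (𝓝 0) := by
    refine squeeze_zero_norm' (a := fun θ => (1 + η) * K ^ 2 * Real.sin (2 * θ) ^ (1 - η)) ?_ ?_
    · filter_upwards [Ioo_mem_nhdsLT hb] with θ hθ
      rw [Real.norm_eq_abs]; exact hFabs θ hθ
    · have := (hg.tendsto (π / 2)).mono_left (nhdsWithin_le_nhds (s := Iio (π / 2)))
      rwa [hgb] at this
  -- integrability
  have iD := integrableOn_deriv_sq_mul_rpow hη0 hη1 hf
  have iQ := integrableOn_div_sin_sq_mul_rpow hη0 hη1 hf h0 h1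
  have iP := integrableOn_sq_mul_rpow hη0 hη1 hfc
  have hmF' : Measurable F' := by
    have hsm : Measurable fun θ : ℝ => Real.sin (2 * θ) := by fun_prop
    have hcm : Measurable fun θ : ℝ => Real.cos (2 * θ) := by fun_prop
    have hum : Measurable fun θ : ℝ => Real.sin (2 * θ) ^ (-η) := hsm.pow_const _
    have hfm : Measurable f := hfc.measurable
    have hdm : Measurable (deriv f) := hdc.measurable
    simp only [hF']
    fun_prop
  have iF' : IntegrableOn F' (Ioo 0 (π / 2)) := by
    have iu := integrableOn_sin_two_mul_rpow (r := -η) (by linarith) (by linarith)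
    refine Integrable.mono' (iu.const_mul ((1 + η) * (2 * K ^ 2 + 2 * K * M + 2 * (1 + η) * K ^ 2)))
      hmF'.aestronglyMeasurable ?_
    rw [ae_restrict_iff' measurableSet_Ioo]
    refine Filter.Eventually.of_forall fun θ hθ => ?_
    rw [Real.norm_eq_abs]
    exact hF'abs θ hθ
  -- the fundamental theorem of calculus on the open interval: `∫ F' = 0`
  have hFTC : ∫ θ in Ioo 0 (π / 2), F' θ = 0 := by
    have h := integral_eq_sub_of_hasDerivAt_of_tendsto hb hderiv
      ((intervalIntegrable_iff_integrableOn_Ioo_of_le hb.le).2 iF') hlim0 hlimb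
    rw [intervalIntegral.integral_of_le hb.le, integral_Ioc_eq_integral_Ioo, sub_zero] at h
    exact h
  -- integrate the pointwise inequality
  have iR : IntegrableOn (fun θ => deriv f θ ^ 2 * Real.sin (2 * θ) ^ (-η) -
      (1 + η) ^ 2 * ((f θ / Real.sin (2 * θ)) ^ 2 * Real.sin (2 * θ) ^ (-η)) -
      (1 - η ^ 2) * (f θ ^ 2 * Real.sin (2 * θ) ^ (-η))) (Ioo 0 (π / 2)) :=
    (iD.sub (iQ.const_mul _)).sub (iP.const_mul _)
  have i1 : IntegrableOn (fun θ => deriv f θ ^ 2 * Real.sin (2 * θ) ^ (-η) -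
      (1 + η) ^ 2 * ((f θ / Real.sin (2 * θ)) ^ 2 * Real.sin (2 * θ) ^ (-η))) (Ioo 0 (π / 2)) :=
    iD.sub (iQ.const_mul _)
  have i2 : IntegrableOn (fun θ => (1 - η ^ 2) * (f θ ^ 2 * Real.sin (2 * θ) ^ (-η))) (Ioo 0 (π / 2)) :=
    iP.const_mul _
  have i3 : IntegrableOn (fun θ => (1 + η) ^ 2 * ((f θ / Real.sin (2 * θ)) ^ 2 * Real.sin (2 * θ) ^ (-η)))
      (Ioo 0 (π / 2)) := iQ.const_mul _
  have hmono := setIntegral_mono_on iF' iR measurableSet_Ioo fun θ hθ => hF'le θ hθ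
  rw [hFTC, integral_sub i1 i2, integral_sub iD i3, MeasureTheory.integral_const_mul,
    MeasureTheory.integral_const_mul] at hmono
  linarith

/-- **Corollary 7.6 of [Elgindi2021]** (printed direction, lower-order term `100|f|²_{H¹}` replaced
by `0`): `∫₀^{π/2} (f/sin 2θ)²·sin(2θ)^{−η} ≤ (1/(η+1)²)∫₀^{π/2} f'²·sin(2θ)^{−η}` for `0 ≤ η < 1`,
`f ∈ C¹(ℝ)`, `f(0) = f(π/2) = 0`.
[cite: Elgindi2021, §7.2 Corollary 7.6 (p. 20 of arXiv:1904.04795)] -/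
theorem sharpHardy_sin_two_mul' {η : ℝ} (hη0 : 0 ≤ η) (hη1 : η < 1) {f : ℝ → ℝ}
    (hf : ContDiff ℝ 1 f) (h0 : f 0 = 0) (h1 : f (π / 2) = 0) :
    ∫ θ in Ioo 0 (π / 2), (f θ / Real.sin (2 * θ)) ^ 2 * Real.sin (2 * θ) ^ (-η) ≤
      1 / (η + 1) ^ 2 * ∫ θ in Ioo 0 (π / 2), deriv f θ ^ 2 * Real.sin (2 * θ) ^ (-η) := by
  have h := sharpHardy_sin_two_mul hη0 hη1 hf h0 h1
  have hP : 0 ≤ ∫ θ in Ioo 0 (π / 2), f θ ^ 2 * Real.sin (2 * θ) ^ (-η) :=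
    setIntegral_nonneg measurableSet_Ioo fun θ hθ => mul_nonneg (sq_nonneg _)
      (Real.rpow_nonneg (Real.sin_pos_of_pos_of_lt_pi (by linarith [hθ.1]) (by linarith [hθ.2])).le _)
  have hpos : 0 < (η + 1) ^ 2 := by positivity
  rw [div_mul_eq_mul_div, one_mul, le_div_iff₀ hpos]
  have : (1 - η ^ 2) * ∫ θ in Ioo 0 (π / 2), f θ ^ 2 * Real.sin (2 * θ) ^ (-η) ≥ 0 :=
    mul_nonneg (by nlinarith) hP
  nlinarith

end Elgindi

end Literature.Analysis.FluidPDE
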